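/-
Copyright (c) 2026. All rights reserved.
Released under Apache 2.0 license as described in the file LICENSE.
-/
import Mathlib
import HarnessLib
import Literature.Topology.FourManifolds.WhitneyCircleIsotopy
import Literature.Topology.FourManifolds.CloseMapsHomotopic
import Literature.Topology.FourManifolds.MapSmoothing

/-!
# Whitney for circles keeping the homotopy class; smoothing an annulus keeping the homotopy class

Topic `Literature/Topology/FourManifolds`. Module W of the proof of
`Literature.Topology.FourManifolds.exists_middleLevel_isStabilization_of_isHCobordism` (Kirby 1989,
Ch. X pp. 55–56, odd case): to drag an attaching circle along a prescribed loop of circles one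
needs an isotopy *in the homotopy class of the loop*.  Two supplements to the tree's Whitney /
smoothing theorems, both proved:

* `exists_smoothIsotopy_homotopicRel` — the general-position theorem
  `isSmoothlyIsotopic_of_contMDiff_homotopy` (`WhitneyCircleIsotopy.lean`) with the extra
  conclusion that the isotopy's family is homotopic to the input smooth homotopy `H` relative to
  `{t ∉ (1/8, 7/8)}`: the same induction over rectangles, imposing at each generic step
  (`exists_chartPerturb_stagesGoodOn`, which respects finite families of `MapsTo` constraints)
  closeness to the previous family in the sense of the cover of
  `exists_cover_homotopic_of_mapsTo` (`CloseMapsHomotopic.lean`), whose homotopies do not move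
  unchanged points.
* `exists_contMDiff_homotopicRel_annulus` — a continuous annulus `ℝ × S¹ → V` with smooth
  constant ends is homotopic rel ends to a smooth one with constant ends (relative smoothing with
  closeness constraints, `exists_contMDiff_eqOn_mapsTo`, `MapSmoothing.lean`).

No definitions; no named facts.

## References

* H. Whitney, *Differentiable manifolds*, Ann. of Math. (2) 37 (1936), 645–680, §II Thm. 6,
  §§8–9. [Whitney1936]
* J. Milnor, *Lectures on the h-cobordism theorem* (1965), Thm. 8.4 and Remark (PDF p. 56).
  [MilnorHCobordism1965]
* M. W. Hirsch, *Differential Topology*, GTM 33 (1976), Ch. 2 §2 Thm. 2.6, Ch. 8 §1. [HirschDT1976]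
* R. C. Kirby, *The topology of 4-manifolds*, LNM 1374 (1989), Ch. X, pp. 55–56. [Kirby1989]
-/

open scoped Manifold ContDiff Topology Real
open Function Set Filter

noncomputable section

namespace Literature.Topology.FourManifolds

variable {n : ℕ} {V : Type*} [TopologicalSpace V] [ChartedSpace (EuclideanSpace ℝ (Fin n)) V] [IsManifold (𝓡 n) ∞ V]

/-! ### 1. Whitney's perturbation with the homotopy -/

section Whitney

/-- **Whitney's theorem for circles, with the homotopy.**  Let `V` be a compact Hausdorff manifold
of dimension `n ≥ 4` without boundary, `e₀ e₁ : S¹ → V` smooth embeddings and `H : ℝ × S¹ → V`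
smooth with `H (t, ·) = e₀` for `t ≤ 1/4`, `= e₁` for `t ≥ 3/4`.  Then there is a smooth isotopy
`F` from `e₀` to `e₁` whose family `(t, u) ↦ F t u` is homotopic to `H` relative to
`{t ∉ (1/8, 7/8)}`.  (The proof of `isSmoothlyIsotopic_of_contMDiff_homotopy`, recording at each
generic step that the perturbed family is close to the previous one — the step respects any finite
family of `MapsTo` constraints — hence homotopic to it by a homotopy that does not move the points
left unchanged, `exists_cover_homotopic_of_mapsTo`.) [cite: Whitney1936, §II Thm. 6]
[cite: MilnorHCobordism1965, Thm. 8.4 and Remark (PDF p. 56)] -/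
theorem exists_smoothIsotopy_homotopicRel [T2Space V] [CompactSpace V] (hn : 4 ≤ n)
    {H : ℝ × (Metric.sphere (0 : EuclideanSpace ℝ (Fin 2)) 1) → V}
    (hH : ContMDiff (𝓘(ℝ, ℝ).prod (𝓡 1)) (𝓡 n) ∞ H) {e₀ e₁ : (Metric.sphere (0 : EuclideanSpace ℝ (Fin 2)) 1) → V}
    (he₀ : Manifold.IsSmoothEmbedding (𝓡 1) (𝓡 n) ∞ e₀)
    (he₁ : Manifold.IsSmoothEmbedding (𝓡 1) (𝓡 n) ∞ e₁)
    (h₀ : ∀ t : ℝ, t ≤ 1 / 4 → ∀ u, H (t, u) = e₀ u)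
    (h₁ : ∀ t : ℝ, 3 / 4 ≤ t → ∀ u, H (t, u) = e₁ u) :
    ∃ F : SmoothIsotopy (𝓡 1) (𝓡 n) e₀ e₁,
      (⟨H, hH.continuous⟩ : C(ℝ × (Metric.sphere (0 : EuclideanSpace ℝ (Fin 2)) 1), V)).HomotopicRel
        ⟨uncurry F.toFun, F.contMDiff.continuous⟩
        {p | p.1 ∉ Ioo (1 / 8 : ℝ) (7 / 8)} := by
  -- ### the closeness cover of `V`
  obtain ⟨Uc, hUco, hUcmem, hUchom⟩ := exists_cover_homotopic_of_mapsTo (n := n) V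
  set S₀ : Set (ℝ × (Metric.sphere (0 : EuclideanSpace ℝ (Fin 2)) 1)) := {p | p.1 ∉ Ioo (1 / 8 : ℝ) (7 / 8)} with hS₀def
  -- ### the initial good set
  set A₀ : Set (ℝ × (Metric.sphere (0 : EuclideanSpace ℝ (Fin 2)) 1)) := {p | p.1 ≤ 1 / 4 ∨ 3 / 4 ≤ p.1} with hA₀def
  have hA₀ : StagesGoodOn n H A₀ := by
    refine ⟨fun t s hts => ?_, fun t u u' htu heq => ?_⟩
    · rcases hts with ht | ht
      · rw [thetaVel_eq_of_stage_eq (G := fun p : ℝ × (Metric.sphere (0 : EuclideanSpace ℝ (Fin 2)) 1) => e₀ p.2) (t' := t)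
          (fun u => h₀ t ht u) s]
        exact thetaVel_const_ne_zero he₀.contMDiff he₀.isImmersion t s
      · rw [thetaVel_eq_of_stage_eq (G := fun p : ℝ × (Metric.sphere (0 : EuclideanSpace ℝ (Fin 2)) 1) => e₁ p.2) (t' := t)
          (fun u => h₁ t ht u) s]
        exact thetaVel_const_ne_zero he₁.contMDiff he₁.isImmersion t s
    · rcases htu with ht | ht
      · rw [h₀ t ht, h₀ t ht] at heq
        exact he₀.isEmbedding.injective heq
      · rw [h₁ t ht, h₁ t ht] at heq
        exact he₁.isEmbedding.injective heq
  -- ### a Lebesgue number for the cover of `[1/4, 3/4] × S¹` by preimages of chart sources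
  set Q : Set (ℝ × (Metric.sphere (0 : EuclideanSpace ℝ (Fin 2)) 1)) := Icc (1 / 4 : ℝ) (3 / 4) ×ˢ univ with hQdef
  have hQc : IsCompact Q := isCompact_Icc.prod isCompact_univ
  obtain ⟨lam, hlam, hleb⟩ := lebesgue_number_lemma_of_metric hQc
    (c := fun y : V => H ⁻¹' (chartAt (EuclideanSpace ℝ (Fin n)) y).source)
    (fun y => (chartAt (EuclideanSpace ℝ (Fin n)) y).open_source.preimage hH.continuous)
    (fun p _ => mem_iUnion.2 ⟨H p, mem_chart_source _ _⟩)
  haveI : Nonempty V := ⟨e₀ (circlePoint 0)⟩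
  choose! yc hyc using hleb
  -- ### sizes of the rectangles
  set δ₀ : ℝ := min (lam / 4) (1 / 16) with hδ₀def
  set α : ℝ := min (lam / 4) (1 / 4) with hαdef
  have hδ₀ : 0 < δ₀ := lt_min (by linarith) (by norm_num)
  have hδ₀lam : 3 * δ₀ < lam := by
    have : δ₀ ≤ lam / 4 := min_le_left _ _
    linarith
  have hδ₀8 : 2 * δ₀ ≤ 1 / 8 := by
    have : δ₀ ≤ 1 / 16 := min_le_right _ _
    linarith
  have hα : 0 < α := lt_min (by linarith) (by norm_num)
  have hαlam : 3 * α < lam := by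
    have : α ≤ lam / 4 := min_le_left _ _
    linarith
  have h3α : 3 * α < π / 2 := by
    have : α ≤ 1 / 4 := min_le_right _ _
    linarith [Real.two_le_pi]
  have hαπ : α ≤ π := by linarith [Real.two_le_pi]
  -- ### the grid and its chart centres
  obtain ⟨N, M, τ, c, hτ, hcover⟩ := exists_grid_cover hδ₀ hα hαπ
  set xc : Fin (N + 1) × Fin (M + 1) → V := fun i => yc (τ i, circlePoint (c i)) with hxcdef
  set K : Fin (N + 1) × Fin (M + 1) → Set (ℝ × (Metric.sphere (0 : EuclideanSpace ℝ (Fin 2)) 1)) := fun i =>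
    Icc (τ i - δ₀) (τ i + δ₀) ×ˢ circleClosedArc (c i) α with hKdef
  set Rc : Fin (N + 1) × Fin (M + 1) → Set (ℝ × (Metric.sphere (0 : EuclideanSpace ℝ (Fin 2)) 1)) := fun i =>
    Icc (τ i - 3 * δ₀) (τ i + 3 * δ₀) ×ˢ circleClosedArc (c i) (3 * α) with hRcdef
  have hRc0 : ∀ i, MapsTo H (Rc i) (chartAt (EuclideanSpace ℝ (Fin n)) (xc i)).source := by
    intro i p hp
    have hQi : ((τ i, circlePoint (c i)) : ℝ × (Metric.sphere (0 : EuclideanSpace ℝ (Fin 2)) 1)) ∈ Q := ⟨hτ i, mem_univ _⟩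
    have hball := hyc _ hQi
    apply hball
    rw [Metric.mem_ball, Prod.dist_eq, max_lt_iff]
    refine ⟨?_, ?_⟩
    · rw [Real.dist_eq, abs_lt]
      obtain ⟨h1, h2⟩ := hp.1
      exact ⟨by linarith, by linarith⟩
    · exact (dist_le_of_mem_circleClosedArc (by linarith) hp.2).trans_lt hαlam
  -- the bump of rectangle `i` vanishes on `S₀`
  have hbumpS₀ : ∀ i, ∀ p ∈ S₀, rectBump (τ i) δ₀ (c i) α p = 0 := by
    intro i p hp
    apply rectBump_eq_zero_of_time hδ₀
    intro ht
    apply hp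
    obtain ⟨hτ1, hτ2⟩ := hτ i
    exact ⟨by linarith [ht.1], by linarith [ht.2]⟩
  -- the bump of rectangle `i` vanishes off `Rc i`
  have hbumpRc : ∀ i p, p ∉ Rc i → rectBump (τ i) δ₀ (c i) α p = 0 := by
    intro i p hp
    by_contra h
    exact hp (rect_subset_closedRect _ _ _ _ (tsupport_rectBump_subset_rect hδ₀ hα h3α
      (subset_tsupport _ (mem_support.2 h))))
  -- ### induction over the rectangles of the grid, keeping the homotopy class rel `S₀`
  have hind : ∀ S : Finset (Fin (N + 1) × Fin (M + 1)), ∃ G : ℝ × (Metric.sphere (0 : EuclideanSpace ℝ (Fin 2)) 1) → V,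
      ∃ hGs : ContMDiff (𝓘(ℝ, ℝ).prod (𝓡 1)) (𝓡 n) ∞ G, StagesGoodOn n G (A₀ ∪ ⋃ i ∈ S, K i) ∧
      (∀ j, MapsTo G (Rc j) (chartAt (EuclideanSpace ℝ (Fin n)) (xc j)).source) ∧
      (∀ p : ℝ × (Metric.sphere (0 : EuclideanSpace ℝ (Fin 2)) 1), p.1 ∉ Ioo (1 / 8 : ℝ) (7 / 8) → G p = H p) ∧
      (⟨H, hH.continuous⟩ : C(ℝ × (Metric.sphere (0 : EuclideanSpace ℝ (Fin 2)) 1), V)).HomotopicRel ⟨G, hGs.continuous⟩ S₀ := by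
    intro S
    induction S using Finset.induction_on with
    | empty =>
      refine ⟨H, hH, ?_, hRc0, fun p _ => rfl, ContinuousMap.HomotopicRel.refl _⟩
      simpa using hA₀
    | @insert i S hiS ih =>
      obtain ⟨G, hGs, hGA, hGRc, hGH, hGhom⟩ := ih
      -- compact pieces of `Rc i` on which `G` stays in one member of the closeness cover
      have hnb : ∀ p : ℝ × (Metric.sphere (0 : EuclideanSpace ℝ (Fin 2)) 1), ∃ Kp : Set (ℝ × (Metric.sphere (0 : EuclideanSpace ℝ (Fin 2)) 1)),
          IsCompact Kp ∧ Kp ∈ 𝓝 p ∧ MapsTo G Kp (Uc (G p)) := by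
        intro p
        have hWo : IsOpen (G ⁻¹' Uc (G p)) := (hUco _).preimage hGs.continuous
        obtain ⟨L, hLc, hpL, hLW⟩ := exists_compact_between isCompact_singleton hWo
          (singleton_subset_iff.2 (hUcmem (G p)))
        exact ⟨L, hLc, mem_interior_iff_mem_nhds.1 (hpL (mem_singleton p)), fun q hq => hLW hq⟩
      choose Kp hKpc hKpn hKpU using hnb
      obtain ⟨t, -, htK⟩ := (isCompact_closedRect (τ i) δ₀ (c i) α).elim_nhds_subcover Kp fun p _ => hKpn p
      -- the extended family of constraints
      set C' : (Fin (N + 1) × Fin (M + 1)) ⊕ (t : Set (ℝ × (Metric.sphere (0 : EuclideanSpace ℝ (Fin 2)) 1))) →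
          Set (ℝ × (Metric.sphere (0 : EuclideanSpace ℝ (Fin 2)) 1)) := Sum.elim Rc fun p => Kp p with hC'
      set U' : (Fin (N + 1) × Fin (M + 1)) ⊕ (t : Set (ℝ × (Metric.sphere (0 : EuclideanSpace ℝ (Fin 2)) 1))) → Set V :=
        Sum.elim (fun j => (chartAt (EuclideanSpace ℝ (Fin n)) (xc j)).source) fun p => Uc (G p) with hU'
      have hC'c : ∀ j, IsCompact (C' j) := by
        rintro (j | p)
        · exact isCompact_closedRect (τ j) δ₀ (c j) α
        · exact hKpc p
      have hU'o : ∀ j, IsOpen (U' j) := by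
        rintro (j | p)
        · exact (chartAt (EuclideanSpace ℝ (Fin n)) (xc j)).open_source
        · exact hUco _
      have hCU' : ∀ j, MapsTo G (C' j) (U' j) := by
        rintro (j | p)
        · exact hGRc j
        · exact hKpU p
      obtain ⟨q, hG's, hG'A, hG'CU, hG'eq⟩ := exists_chartPerturb_stagesGoodOn hn hGs hGA hδ₀ hα
        h3α (x := xc i) (hGRc i) hC'c hU'o hCU'
      set G' := chartPerturb G (xc i) (rectBump (τ i) δ₀ (c i) α) (angSin (c i)) q with hG'def
      -- `G` and `G'` are close, hence homotopic without moving the unchanged points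
      have hclose : ∀ p, ∃ y, G p ∈ Uc y ∧ G' p ∈ Uc y := by
        intro p
        by_cases hp : p ∈ Rc i
        · obtain ⟨p₀, hp₀t, hp₀⟩ := mem_iUnion₂.1 (htK hp)
          exact ⟨G p₀, hKpU p₀ hp₀, hG'CU (Sum.inr ⟨p₀, hp₀t⟩) hp₀⟩
        · refine ⟨G p, hUcmem _, ?_⟩
          rw [hG'eq p (hbumpRc i p hp)]
          exact hUcmem _
      obtain ⟨Hm, hHm⟩ := hUchom ⟨G, hGs.continuous⟩ ⟨G', hG's.continuous⟩ hclose
      have hrel : (⟨G, hGs.continuous⟩ : C(ℝ × (Metric.sphere (0 : EuclideanSpace ℝ (Fin 2)) 1), V)).HomotopicRel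
          ⟨G', hG's.continuous⟩ S₀ :=
        ⟨{ toHomotopy := Hm
           prop' := fun s p hp => hHm s p (by change G p = G' p; rw [hG'eq p (hbumpS₀ i p hp)]) }⟩
      refine ⟨G', hG's, ?_, fun j => hG'CU (Sum.inl j), fun p hp => ?_, hGhom.trans hrel⟩
      · refine hG'A.mono ?_
        intro p hp
        rw [Finset.set_biUnion_insert] at hp
        rcases hp with hp | hp | hp
        · exact Or.inl (Or.inl hp)
        · exact Or.inr hp
        · exact Or.inl (Or.inr hp)
      · rw [hG'eq p (hbumpS₀ i p hp), hGH p hp]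
  obtain ⟨G, hGs, hGA, -, hGH, hGhom⟩ := hind Finset.univ
  -- ### every stage of the final family is good
  have hgood : StagesGoodOn n G univ := by
    refine hGA.mono fun p _ => ?_
    by_cases hp : p.1 ∈ Icc (1 / 4 : ℝ) (3 / 4)
    · obtain ⟨i, hi⟩ := hcover p hp
      exact Or.inr (mem_iUnion₂.2 ⟨i, Finset.mem_univ i, hi⟩)
    · refine Or.inl ?_
      rw [mem_Icc, not_and_or, not_le, not_le] at hp
      rcases hp with hp | hp
      · exact Or.inl hp.le
      · exact Or.inr hp.le
  -- ### the smooth isotopy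
  refine ⟨{ toFun := fun t u => G (t, u)
            contMDiff := hGs
            isSmoothEmbedding := fun t => isSmoothEmbedding_stage hGs hgood t
            map_zero := ?_
            map_one := ?_ }, ?_⟩
  · funext u
    rw [hGH (0, u) (fun h => absurd h.1 (by norm_num)), h₀ 0 (by norm_num) u]
  · funext u
    rw [hGH (1, u) (fun h => absurd h.2 (by norm_num)), h₁ 1 (by norm_num) u]
  · exact hGhom

end Whitney

/-! ### 2. Smoothing an annulus rel ends, keeping the homotopy class -/

section Smoothing

/-- **Smoothing a continuous annulus with smooth constant ends, with the homotopy.**  Let `V` be a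
compact Hausdorff `n`-manifold without boundary, `e : S¹ → V` smooth and `A : ℝ × S¹ → V`
continuous with `A (t, ·) = e` for `t ≤ 1/3` and for `t ≥ 2/3`.  Then there is a smooth
`H : ℝ × S¹ → V` with `H (t, ·) = e` for `t ≤ 1/4` and `t ≥ 3/4`, homotopic to `A` relative to
`{t ≤ 1/4} ∪ {t ≥ 3/4}` (relative smoothing with closeness constraints,
`exists_contMDiff_eqOn_mapsTo`, and `exists_cover_homotopic_of_mapsTo`).
[cite: HirschDT1976, Ch. 2 §2 Thm. 2.6] -/
theorem exists_contMDiff_homotopicRel_annulus [T2Space V] [CompactSpace V]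
    {e : (Metric.sphere (0 : EuclideanSpace ℝ (Fin 2)) 1) → V} (he : ContMDiff (𝓡 1) (𝓡 n) ∞ e)
    (A : C(ℝ × (Metric.sphere (0 : EuclideanSpace ℝ (Fin 2)) 1), V))
    (hA₀ : ∀ t : ℝ, t ≤ 1 / 3 → ∀ u, A (t, u) = e u) (hA₁ : ∀ t : ℝ, 2 / 3 ≤ t → ∀ u, A (t, u) = e u) :
    ∃ H : ℝ × (Metric.sphere (0 : EuclideanSpace ℝ (Fin 2)) 1) → V, ∃ hH : ContMDiff (𝓘(ℝ, ℝ).prod (𝓡 1)) (𝓡 n) ∞ H,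
      (∀ t : ℝ, t ≤ 1 / 4 → ∀ u, H (t, u) = e u) ∧ (∀ t : ℝ, 3 / 4 ≤ t → ∀ u, H (t, u) = e u) ∧
      A.HomotopicRel ⟨H, hH.continuous⟩ {p | p.1 ≤ 1 / 4 ∨ 3 / 4 ≤ p.1} := by
  obtain ⟨Uc, hUco, hUcmem, hUchom⟩ := exists_cover_homotopic_of_mapsTo (n := n) V
  set S : Set (ℝ × (Metric.sphere (0 : EuclideanSpace ℝ (Fin 2)) 1)) := {p | p.1 ≤ 1 / 4 ∨ 3 / 4 ≤ p.1} with hSdef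
  set W : Set (ℝ × (Metric.sphere (0 : EuclideanSpace ℝ (Fin 2)) 1)) := {p | p.1 < 1 / 3 ∨ 2 / 3 < p.1} with hWdef
  have hSc : IsClosed S :=
    (isClosed_le continuous_fst continuous_const).union (isClosed_le continuous_const continuous_fst)
  have hWo : IsOpen W :=
    (isOpen_lt continuous_fst continuous_const).union (isOpen_lt continuous_const continuous_fst)
  have hSW : S ⊆ W := fun p hp => hp.imp (fun h => by linarith) (fun h => by linarith)
  -- `A` is smooth on `W`, where it is the constant family `e`
  have hAW : ContMDiffOn (𝓘(ℝ, ℝ).prod (𝓡 1)) (𝓡 n) ∞ A W := by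
    intro p hp
    have hes : ContMDiff (𝓘(ℝ, ℝ).prod (𝓡 1)) (𝓡 n) ∞ fun p : ℝ × (Metric.sphere (0 : EuclideanSpace ℝ (Fin 2)) 1) => e p.2 :=
      he.comp contMDiff_snd
    rcases hp with hp | hp
    · have hev : (A : ℝ × (Metric.sphere (0 : EuclideanSpace ℝ (Fin 2)) 1) → V) =ᶠ[𝓝 p]
          fun p : ℝ × (Metric.sphere (0 : EuclideanSpace ℝ (Fin 2)) 1) => e p.2 := by
        filter_upwards [(isOpen_lt continuous_fst continuous_const).mem_nhds hp] with p' hp'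
        exact hA₀ p'.1 (le_of_lt hp') p'.2
      exact (hes.contMDiffAt.congr_of_eventuallyEq hev).contMDiffWithinAt
    · have hev : (A : ℝ × (Metric.sphere (0 : EuclideanSpace ℝ (Fin 2)) 1) → V) =ᶠ[𝓝 p]
          fun p : ℝ × (Metric.sphere (0 : EuclideanSpace ℝ (Fin 2)) 1) => e p.2 := by
        filter_upwards [(isOpen_lt continuous_const continuous_fst).mem_nhds hp] with p' hp'
        exact hA₁ p'.1 (le_of_lt hp') p'.2
      exact (hes.contMDiffAt.congr_of_eventuallyEq hev).contMDiffWithinAt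
  -- compact pieces of `[0, 1] × S¹` on which `A` stays in one member of the cover
  have hnb : ∀ p : ℝ × (Metric.sphere (0 : EuclideanSpace ℝ (Fin 2)) 1), ∃ Kp : Set (ℝ × (Metric.sphere (0 : EuclideanSpace ℝ (Fin 2)) 1)),
      IsCompact Kp ∧ Kp ∈ 𝓝 p ∧ MapsTo A Kp (Uc (A p)) := by
    intro p
    have hO : IsOpen (A ⁻¹' Uc (A p)) := (hUco _).preimage A.continuous
    obtain ⟨L, hLc, hpL, hLW⟩ := exists_compact_between isCompact_singleton hO
      (singleton_subset_iff.2 (hUcmem (A p)))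
    exact ⟨L, hLc, mem_interior_iff_mem_nhds.1 (hpL (mem_singleton p)), fun q hq => hLW hq⟩
  choose Kp hKpc hKpn hKpU using hnb
  have hQc : IsCompact (Icc (0 : ℝ) 1 ×ˢ (univ : Set (Metric.sphere (0 : EuclideanSpace ℝ (Fin 2)) 1))) :=
    isCompact_Icc.prod isCompact_univ
  obtain ⟨t, -, htK⟩ := hQc.elim_nhds_subcover Kp fun p _ => hKpn p
  obtain ⟨g, hgs, hgS, hgU⟩ := exists_contMDiff_eqOn_mapsTo (IM := 𝓘(ℝ, ℝ).prod (𝓡 1)) A.continuous hSc hWo hSW hAW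
    (C := fun p : (t : Set (ℝ × (Metric.sphere (0 : EuclideanSpace ℝ (Fin 2)) 1))) => Kp p) (U := fun p => Uc (A p))
    (fun p => hKpc p) (fun p => hUco _) fun p => hKpU p
  -- closeness of `A` and `g`
  have hclose : ∀ p, ∃ y, A p ∈ Uc y ∧ g p ∈ Uc y := by
    intro p
    by_cases hp : p ∈ Icc (0 : ℝ) 1 ×ˢ (univ : Set (Metric.sphere (0 : EuclideanSpace ℝ (Fin 2)) 1))
    · obtain ⟨p₀, hp₀t, hp₀⟩ := mem_iUnion₂.1 (htK hp)
      exact ⟨A p₀, hKpU p₀ hp₀, hgU ⟨p₀, hp₀t⟩ hp₀⟩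
    · have hpS : p ∈ S := by
        rw [mem_prod, mem_Icc, not_and_or, not_and_or] at hp
        rcases hp with (hp | hp) | hp
        · exact Or.inl (by linarith [not_le.mp hp])
        · exact Or.inr (by linarith [not_le.mp hp])
        · exact absurd (mem_univ _) hp
      refine ⟨A p, hUcmem _, ?_⟩
      rw [hgS hpS]
      exact hUcmem _
  obtain ⟨Hm, hHm⟩ := hUchom A ⟨g, hgs.continuous⟩ hclose
  refine ⟨g, hgs, fun t ht u => ?_, fun t ht u => ?_,
    ⟨{ toHomotopy := Hm, prop' := fun s p hp => hHm s p (hgS hp).symm }⟩⟩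
  · rw [show g (t, u) = A (t, u) from hgS (Or.inl ht)]; exact hA₀ t (by linarith) u
  · rw [show g (t, u) = A (t, u) from hgS (Or.inr ht)]; exact hA₁ t (by linarith) u

end Smoothing

end Literature.Topology.FourManifolds
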